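import Summits.SmoothPoincare4.SmoothPoincare4.Theses.EntropyRung
import Literature.Geometry.Riemannian.RoundSphereProofs
import Literature.Geometry.Riemannian.AubinYamabeSphereEuclidean
import HarnessLib

/-!
# The cone-core metric identity `δ = Λ² ι^* g` on Mathlib's `S⁴`
(stub `helper_sphereConeMetric` of the `S⁴` instance of `stub_coneCoreExistence`, line
`green-blowup-conformal-entropy`, crux `EntropyRung.SubcylindricalExistence`,
item stmt-SmoothPoincare4-10871)

On Mathlib's unit sphere `S⁴ = Metric.sphere (0 : EuclideanSpace ℝ (Fin 5)) 1` with the round metric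
`g_S = roundMetric` and a warped metric `g = W² g_S` (`W > 0`, HYPOTHESIS `hgval`), read in the
rescaled stereographic chart at the antipode `-p`,
`ι u := (extChartAt (𝓡 4) (-p))⁻¹ (4 • u)`, and given the chart height formula
`⟪(extChartAt (𝓡 4) (-p))⁻¹ z, p⟫ = -(4 − ‖z‖²)/(4 + ‖z‖²)` (HYPOTHESIS), the Euclidean metric of
`ℝ⁴` is `Λ² ι^* g` with `Λ = (G_S/W)/4`, `G_S = 2/(1 − ⟪x, p⟫)`:

* chain rule: `dι_q v = d(σ⁻¹)_{4q} (4 v)` (`HasMFDerivAt.comp`);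
* `g_S(dσ⁻¹_z X, dσ⁻¹_z Y) = (4/(‖z‖² + 4))² ⟪X, Y⟫` (`roundMetric_mfderiv_extChartAt_symm`,
  Lee 2018, Ch. 3: stereographic coordinates are conformal);
* `2/(1 − ⟪σ⁻¹ z, p⟫) = (4 + ‖z‖²)/4`, and the algebra
  `((4 + ‖z‖²)/4 / W / 4)² · W² · (4/(‖z‖² + 4))² · ⟪4v, 4w⟫ = ⟪v, w⟫`.

Everything is proved; no definition, no named fact.

References: J. M. Lee, *Introduction to Riemannian Manifolds*, 2nd ed. (2018), Ch. 3 (stereographic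
coordinates are conformal) [Lee2018].
-/

noncomputable section

-- the registered namespace `Summit.SmoothPoincare4.SmoothPoincare4.Theorems` repeats a component
set_option linter.dupNamespace false

open scoped Manifold ContDiff Topology ENNReal NNReal ContinuousMap RealInnerProductSpace
open Set Filter MeasureTheory
open Literature.Geometry.Lorentzian Literature.Geometry.Riemannian

namespace Summit.SmoothPoincare4.SmoothPoincare4.Theorems

/-- **Chain rule for the rescaled inverse chart** `ι u := σ⁻¹ (4 • u)` of `S⁴` at `-p`
(`σ = extChartAt (𝓡 4) (-p)`, smooth on all of `ℝ⁴` by `contMDiff_extChartAt_symm_sphere`):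
`dι_q ξ = d(σ⁻¹)_{4q} (4 ξ)`. [folklore] -/
theorem mfderiv_extChartAt_symm_smul_sphere
    [Fact (Module.finrank ℝ (EuclideanSpace ℝ (Fin 5)) = 4 + 1)]
    (p : Metric.sphere (0 : EuclideanSpace ℝ (Fin 5)) 1) (q ξ : EuclideanSpace ℝ (Fin 4)) :
    mfderiv (𝓡 4) (𝓡 4)
        (fun u : EuclideanSpace ℝ (Fin 4) ↦ (extChartAt (𝓡 4) (-p)).symm ((4 : ℝ) • u)) q ξ =
      mfderiv 𝓘(ℝ, EuclideanSpace ℝ (Fin 4)) (𝓡 4) (extChartAt (𝓡 4) (-p)).symm ((4 : ℝ) • q)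
        ((4 : ℝ) • ξ) := by
  have hdiff : MDifferentiableAt 𝓘(ℝ, EuclideanSpace ℝ (Fin 4)) (𝓡 4)
      (extChartAt (𝓡 4) (-p)).symm ((4 : ℝ) • q) :=
    (contMDiff_extChartAt_symm_sphere (n := 4) (EuclideanSpace ℝ (Fin 5)) (-p) 1).mdifferentiableAt
      one_ne_zero
  have hsmul : HasMFDerivAt 𝓘(ℝ, EuclideanSpace ℝ (Fin 4)) 𝓘(ℝ, EuclideanSpace ℝ (Fin 4))
      (fun u : EuclideanSpace ℝ (Fin 4) ↦ (4 : ℝ) • u) q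
      ((4 : ℝ) • ContinuousLinearMap.id ℝ (EuclideanSpace ℝ (Fin 4))) :=
    ((hasFDerivAt_id q).const_smul (4 : ℝ)).hasMFDerivAt
  have hcomp : HasMFDerivAt (𝓡 4) (𝓡 4)
      (fun u : EuclideanSpace ℝ (Fin 4) ↦ (extChartAt (𝓡 4) (-p)).symm ((4 : ℝ) • u)) q
      ((mfderiv 𝓘(ℝ, EuclideanSpace ℝ (Fin 4)) (𝓡 4) (extChartAt (𝓡 4) (-p)).symm
        ((4 : ℝ) • q)).comp ((4 : ℝ) • ContinuousLinearMap.id ℝ (EuclideanSpace ℝ (Fin 4)))) :=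
    hdiff.hasMFDerivAt.comp q hsmul
  rw [hcomp.mfderiv]
  rfl

/-- **The cone-core metric identity on `S⁴`** (registered stub `helper_sphereConeMetric`): for
`g = W² g_S` on Mathlib's `S⁴` and the rescaled inverse stereographic chart
`ι u = (extChartAt (𝓡 4) (-p))⁻¹ (4 • u)` with height `⟪ι(z/4), p⟫ = -(4 − ‖z‖²)/(4 + ‖z‖²)`, the
Euclidean metric of `ℝ⁴` equals `Λ² ι^* g` pointwise, `Λ = (2/(1 − ⟪ι q, p⟫))/W(ι q)/4`: chain rule,
`roundMetric_mfderiv_extChartAt_symm` (`g_S = (4/(‖z‖² + 4))² δ` in the chart) and algebra.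
[cite: Lee2018, Ch. 3, stereographic coordinates] -/
theorem helper_sphereConeMetric :
    ∀ [Fact (Module.finrank ℝ (EuclideanSpace ℝ (Fin 5)) = 4 + 1)] (p : Metric.sphere (0 :
      EuclideanSpace ℝ (Fin 5)) 1) (g : PseudoRiemannianMetric (𝓡 4) ∞ (EuclideanSpace ℝ (Fin 4))
      (TangentSpace (𝓡 4) : Metric.sphere (0 : EuclideanSpace ℝ (Fin 5)) 1 → Type _)) (W :
      Metric.sphere (0 : EuclideanSpace ℝ (Fin 5)) 1 → ℝ), (∀ x, 0 < W x) → (∀ (x : Metric.sphere (0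
      : EuclideanSpace ℝ (Fin 5)) 1) (v w : TangentSpace (𝓡 4) x), g.val x v w = W x ^ 2 *
      (@roundMetric (EuclideanSpace ℝ (Fin 5)) _ _ 4 _).val x v w) → (∀ z : EuclideanSpace ℝ (Fin
      4), ⟪(((extChartAt (𝓡 4) (-p)).symm z : Metric.sphere (0 : EuclideanSpace ℝ (Fin 5)) 1) :
      EuclideanSpace ℝ (Fin 5)), (p : EuclideanSpace ℝ (Fin 5))⟫ = -((4 - ‖z‖ ^ 2) / (4 + ‖z‖ ^ 2)))
      → ∀ (q : EuclideanSpace ℝ (Fin 4)) (v w : TangentSpace (𝓡 4) q), (euclideanMetric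
      (EuclideanSpace ℝ (Fin 4))).val q v w = ((2 / (1 - ⟪((((extChartAt (𝓡 4) (-p)).symm ((4 : ℝ) •
      q)) : Metric.sphere (0 : EuclideanSpace ℝ (Fin 5)) 1) : EuclideanSpace ℝ (Fin 5)), (p :
      EuclideanSpace ℝ (Fin 5))⟫)) / W ((extChartAt (𝓡 4) (-p)).symm ((4 : ℝ) • q)) / 4) ^ 2 * g.val
      ((extChartAt (𝓡 4) (-p)).symm ((4 : ℝ) • q)) (mfderiv (𝓡 4) (𝓡 4) (fun u : EuclideanSpace ℝ
      (Fin 4) ↦ (extChartAt (𝓡 4) (-p)).symm ((4 : ℝ) • u)) q v) (mfderiv (𝓡 4) (𝓡 4) (fun u :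
      EuclideanSpace ℝ (Fin 4) ↦ (extChartAt (𝓡 4) (-p)).symm ((4 : ℝ) • u)) q w) := by
  intro _ p g W hW hgval hchart q v w
  -- `2/(1 − ⟪σ⁻¹ z, p⟫) = (4 + ‖z‖²)/4`
  have hF : ∀ z : EuclideanSpace ℝ (Fin 4),
      2 / (1 - ⟪(((extChartAt (𝓡 4) (-p)).symm z : Metric.sphere (0 : EuclideanSpace ℝ (Fin 5)) 1) :
        EuclideanSpace ℝ (Fin 5)), (p : EuclideanSpace ℝ (Fin 5))⟫) = (4 + ‖z‖ ^ 2) / 4 := by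
    intro z
    rw [hchart z, sub_neg_eq_add]
    have h4 : (4 : ℝ) + ‖z‖ ^ 2 ≠ 0 := by positivity
    field_simp
    ring
  -- the Euclidean metric is the inner product of `ℝ⁴` (stated through the instance path of `ℝ⁴`
  -- itself, so that both sides below carry syntactically the same inner product)
  have hL : (euclideanMetric (EuclideanSpace ℝ (Fin 4))).val q v w =
      @inner ℝ (EuclideanSpace ℝ (Fin 4)) _ v w :=
    euclideanMetric_apply q v w
  rw [hL, mfderiv_extChartAt_symm_smul_sphere p q v, mfderiv_extChartAt_symm_smul_sphere p q w,
    hgval, roundMetric_mfderiv_extChartAt_symm, hF, real_inner_smul_left, real_inner_smul_right]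
  have hW0 : W ((extChartAt (𝓡 4) (-p)).symm ((4 : ℝ) • q)) ≠ 0 := (hW _).ne'
  have h4 : (4 : ℝ) + ‖(4 : ℝ) • q‖ ^ 2 ≠ 0 := by positivity
  have h4' : ‖(4 : ℝ) • q‖ ^ 2 + 4 ≠ 0 := by positivity
  field_simp
  ring

end Summit.SmoothPoincare4.SmoothPoincare4.Theorems

end
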